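import Literature.NumberTheory.Automorphic.LanglandsTunnellReduction
import Literature.NumberTheory.Automorphic.AutomorphicTwistBJ
import Literature.NumberTheory.GaloisRepresentations.IntegralGaloisActionProofs
import HarnessLib

/-!
# Langlands–Tunnell: the quadratic twist `π ⊗ ω_{E/F}` from Artin reciprocity

Trunk AutomorphicL / family `lang` (topic `NumberTheory/Automorphic`).  Everything in this file is
PROVED (no `sorry`, no definition, no new named fact).

In Tunnell's proof of the octahedral case (Tunnell 1981, p. 174: "there are exactly two classes
of cuspidal representations `π_1` and `π_2 = π_1 ⊗ ω_{E/F}` of `GL_2(𝐀_F)` such that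
`BC_{E/F}(π_i) = π(ρ_E)`"; Gelbart 1997, §7.2) the second candidate is the twist of the first by
the quadratic idèle class character `ω_{E/F}` of the quadratic extension `E/F`.  In the
decomposition of lang.S30 this is the named fact
`Literature.NumberTheory.Automorphic.exists_twist_quadraticSign` (`TunnellOctahedralGlobal`): for a
quadratic extension `E/F` and a cuspidal `π` on `GL_n(𝔸_F)` there is a cuspidal `π'` on
`GL_n(𝔸_F)` with Satake parameter `ε_{E/F}(v) · t_{π,v}` at almost every `v` (`quadraticSign`:
`+1` at split, `-1` at inert `v`).  This file **proves** it from Artin reciprocity for characters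
(`Literature.NumberTheory.GaloisRepresentations.artinReciprocity_character`, Tate, Cassels–Fröhlich
Ch. VII — already a leaf of the decomposition):

* `exists_heckeCharacter_quadraticSign` — **proved.**  The quadratic character
  `χ_{E/F} : Γ_F → {±1}` with kernel `Gal(F̄/E)` (open of index `2`) is an Artin representation of
  rank one; its Hecke character `ω = ω_{E/F}` (Artin reciprocity, `hR`) has finite order and, at
  almost every `v` (namely `v` unramified in `E` and for `χ_{E/F}`), `ω` is unramified with
  `ω(ϖ_v) = χ_{E/F}(Frob_v) = ε_{E/F}(v)`: a Frobenius in `Gal(F̄/E)` means `v` splits (all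
  places above `v` of residue degree `1`), a Frobenius outside means `v` is inert
  (`GaloisRepresentations/FrobeniusPlaces`, prime degree `2`; Frobenius elements exist,
  `exists_isArithFrobAt_of_mem_primesAbove_holds`).
* `exists_twist_quadraticSign_of_reciprocity` — **the named fact `exists_twist_quadraticSign`
  from `artinReciprocity_character`**: `π' = π ⊗ (ω_{E/F} ∘ det)`, the twist in the Borel–Jacquet
  model (`CuspidalAutomorphicRepData.twist`, `AutomorphicTwistBJ`), whose Satake parameter at
  almost every `v` is `ω(ϖ_v) · t_{π,v}` (`AutomorphicRepData.eventually_hasSatakeParamAt_twist`,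
  Arthur–Clozel 1989, Ch. 3, proof of Thm. 3.1, p. 172).
* `strongArtin_of_isOctahedralType_of_leaves'`, `strongArtin_of_isSolvable_of_leaves'`,
  `langlands_tunnell_of_leaves'` — the assemblies of `LanglandsTunnellReduction` with the leaf
  `exists_twist_quadraticSign` discharged: lang.S30 now rests on **ten** named facts — Artin
  reciprocity for characters, automorphic induction of characters in prime degree, Langlands'
  base change for `GL(2)` in three forms (`exists_cuspidal_descent_det_cubic`,
  `cuspidal_descent_cyclic`, `ArthurClozel_fibres_quadratic`), the Gelbart–Jacquet adjoint
  lift, Jacquet–Shalika rigidity, the cuspidality of Tunnell's cubic lifts, and Gelbart's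
  Props. 4.1/4.2 over `ℚ`.

## Design notes

* A quadratic extension of a number field is Galois (Mathlib `IsQuadraticExtension.isGalois`,
  characteristic `0`), so the prime-degree Frobenius description of `FrobeniusPlaces` applies to
  the abstract `E/F` of the named fact; `Gal(F̄/E) ≤ Γ_F` is the range of `absGaloisRestrict F E`
  (`isOpen_range_absGaloisRestrict_and_index`, index `[E:F] = 2`, hence normal).
* The twist is by `ω ∘ det` (not its inverse); for the quadratic `ω_{E/F}` the two agree anyway.

## References

* J. Tunnell, *Artin's conjecture for representations of octahedral type*, Bull. AMS (N.S.) 5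
  (1981), p. 174. [Tunnell1981]
* J. Arthur, L. Clozel, *Simple algebras, base change, and the advanced theory of the trace
  formula*, Ann. of Math. Stud. 120 (1989), Ch. 3, proof of Thm. 3.1 (p. 172) and Thm. 4.2 (d).
  [ArthurClozelAMS120]
* J. Tate, *Global class field theory*, in Cassels–Fröhlich (1967), Ch. VII §5.1.
  [CasselsFrohlichANT1967]
* S. Gelbart, *Three lectures …* (1997), §7.2. [Gelbart1997]
-/

noncomputable section

open scoped MatrixGroups NumberField Polynomial
open NumberField IsDedekindDomain Field Polynomial Filter

namespace Literature.NumberTheory.Automorphic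

/-! ### The Hecke character of a quadratic extension and its values at uniformizers -/

section QuadraticCharacter

open GaloisRepresentations

/-- **The quadratic Hecke character `ω_{E/F}` and its Frobenius values** (class field theory for
the quadratic extension `E/F`, through Artin reciprocity for the character `χ_{E/F}` of `Γ_F` with
kernel `Gal(F̄/E)`; Arthur–Clozel 1989, Ch. 3, proof of Thm. 3.1: "`ζ_v = η(ϖ_v)` … is a root of
unity of order `f_v`").  Granting `artinReciprocity_character`: for a quadratic extension `E/F` of
number fields there is a Hecke character `ω` of `F` of finite order which, at almost every finite
place `v` of `F`, is unramified with `ω(ϖ_v) = ε_{E/F}(v)` (`quadraticSign`: `+1` if `v` splits in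
`E`, `-1` if `v` is inert). [cite: CasselsFrohlichANT1967, Ch. VII §5.1 Main Theorem (A), §4.2 Corollary, §2.1]
[cite: ArthurClozelAMS120, Ch. 3, proof of Thm. 3.1 (p. 172)] -/
theorem exists_heckeCharacter_quadraticSign (hR : GaloisRepresentations.artinReciprocity_character)
    (F E : Type) [Field F] [NumberField F] [Field E] [NumberField E] [Algebra F E]
    (h2 : Module.finrank F E = 2) :
    ∃ ω : GaloisRepresentations.HeckeCharacter F, ω.IsFiniteOrder ∧
      ∀ᶠ v : HeightOneSpectrum (𝓞 F) in Filter.cofinite,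
        ω.IsUnramifiedAt v ∧ ω.valueAtUniformizer v = quadraticSign E v := by
  classical
  -- a quadratic extension is Galois
  haveI : FiniteDimensional F E := Module.finite_of_finrank_pos (by rw [h2]; exact two_pos)
  haveI : Algebra.IsQuadraticExtension F E := ⟨h2⟩
  haveI : IsGalois F E := inferInstance
  have hprime : (Module.finrank F E).Prime := by rw [h2]; exact Nat.prime_two
  -- `H = Gal(F̄/E) ≤ Γ_F`, open of index `2`, normal
  set r := absGaloisRestrict F E with hr
  obtain ⟨hHopen, hHi⟩ := isOpen_range_absGaloisRestrict_and_index F E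
  have hHi2 : r.range.index = 2 := hHi.trans h2
  haveI hHn : r.range.Normal := Subgroup.normal_of_index_eq_two hHi2
  -- the quadratic character `χ_{E/F}` as a rank-one Artin representation
  let θ₀ : absoluteGaloisGroup F →* ℂˣ := signCharOfIndexTwo r.range hHi2
  have hθ₀ker : (θ₀.ker : Set (absoluteGaloisGroup F)) = r.range := by
    rw [ker_signCharOfIndexTwo]
  have hθ₀cont : Continuous θ₀ :=
    MonoidHom.continuous_of_isOpen_ker θ₀ (by rw [hθ₀ker]; exact hHopen)
  let θ : absoluteGaloisGroup F →ₜ* ℂˣ := ⟨θ₀, hθ₀cont⟩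
  let ψ : GaloisRepresentations.FramedArtinRep F 1 :=
    ContinuousMonoidHom.comp
      (FramedRep.unitsContinuousMulEquivOfUnique (Fin 1) ℂ : ℂˣ →ₜ* GL (Fin 1) ℂ) θ
  have hψ : ∀ g (i j : Fin 1),
      ((ψ g : GL (Fin 1) ℂ) : Matrix (Fin 1) (Fin 1) ℂ) i j = (θ₀ g : ℂ) := fun g i j => rfl
  have hψ1 : ∀ g, ψ g = 1 ↔ g ∈ r.range := by
    intro g
    constructor
    · intro h
      by_contra hg
      have h1 := congrFun (congrFun (congrArg (fun x : GL (Fin 1) ℂ => (x : Matrix (Fin 1) (Fin 1) ℂ)) h) 0) 0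
      rw [hψ, show θ₀ g = -1 from signCharOfIndexTwo_apply_of_not_mem hHi2 hg,
        Matrix.GeneralLinearGroup.coe_one, Matrix.one_apply_eq, Units.val_neg, Units.val_one] at h1
      norm_num at h1
    · intro hg
      ext i j
      rw [hψ, show θ₀ g = 1 from signCharOfIndexTwo_apply_of_mem hHi2 hg, Units.val_one,
        Matrix.GeneralLinearGroup.coe_one, Subsingleton.elim i j, Matrix.one_apply_eq]
  have hker : IsOpen (ψ.toMonoidHom.ker : Set (absoluteGaloisGroup F)) := by
    have : (ψ.toMonoidHom.ker : Set (absoluteGaloisGroup F)) = r.range := by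
      ext g
      exact hψ1 g
    rw [this]
    exact hHopen
  -- Artin reciprocity: the Hecke character `ω` of `ψ`
  obtain ⟨ω, hωfin, hω⟩ := exists_heckeCharacter_apply_frob_eq hR ψ
  refine ⟨ω, hωfin, ?_⟩
  have hunrψ : ∀ᶠ v in Filter.cofinite, ψ.IsUnramifiedAt v :=
    ψ.eventually_isUnramifiedAt_of_isOpen_ker hker
  have hunrE : ∀ᶠ v : HeightOneSpectrum (𝓞 F) in Filter.cofinite,
      Algebra.IsUnramifiedIn (𝓞 E) v.asIdeal := by
    rw [Filter.eventually_cofinite]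
    exact finite_setOf_not_isUnramifiedIn F E
  filter_upwards [hunrψ, hunrE] with v hψv hvE
  refine ⟨(hω v hψv).1, ?_⟩
  -- a prime above `v` and an arithmetic Frobenius there
  obtain ⟨𝔓, h𝔓⟩ := HeightOneSpectrum.primesAbove_nonempty v
  obtain ⟨Φ, hΦ⟩ := HeightOneSpectrum.exists_isArithFrobAt_of_mem_primesAbove_holds h𝔓
  rw [← (hω v hψv).2 𝔓 h𝔓 Φ hΦ, hψ]
  by_cases hΦH : Φ ∈ r.range
  · -- split: every place above `v` has residue degree `1`
    obtain ⟨c, hc⟩ : ∃ c, c ∉ r.range := by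
      by_contra! hall
      have : r.range = ⊤ := eq_top_iff.mpr fun g _ => hall g
      rw [this, Subgroup.index_top] at hHi2
      exact absurd hHi2 (by norm_num)
    obtain ⟨P, 𝔔, τ, hP, hf1, -, -⟩ :=
      exists_places_split_of_mem_range (F := F) (M := E) hprime hHn hHi hc hvE h𝔓 hΦ hΦH
    rw [show θ₀ Φ = 1 from signCharOfIndexTwo_apply_of_mem hHi2 hΦH, Units.val_one]
    unfold quadraticSign
    rw [if_pos]
    exact ⟨P 0, congrArg HeightOneSpectrum.asIdeal (hP 0).1, hf1 _ (hP 0).1⟩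
  · -- inert: one place above `v`, of residue degree `2`
    have hI : 𝔓.inertia (absoluteGaloisGroup F) ≤ r.range := fun g hg =>
      (hψ1 g).mp (hψv 𝔓 h𝔓 g hg)
    obtain ⟨w, -, -, -, huniq, hfw, -⟩ :=
      exists_place_inert_of_not_mem_range (F := F) (M := E) hprime hHn hHi hvE h𝔓 hI hΦ hΦH
    rw [show θ₀ Φ = -1 from signCharOfIndexTwo_apply_of_not_mem hHi2 hΦH, Units.val_neg,
      Units.val_one]
    unfold quadraticSign
    rw [if_neg]
    rintro ⟨w', hw', hf'⟩
    have hw'v : w'.under (𝓞 F) = v := HeightOneSpectrum.ext hw'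
    have := huniq w' hw'v
    subst this
    rw [hfw, h2] at hf'
    exact absurd hf' (by norm_num)

end QuadraticCharacter

/-! ### The named fact `exists_twist_quadraticSign` from Artin reciprocity -/

section Twist

open scoped Classical

/-- **The quadratic twist `π ⊗ ω_{E/F}` from Artin reciprocity** — the named fact
`exists_twist_quadraticSign` (Tunnell 1981, p. 174: `π_2 = π_1 ⊗ ω_{E/F}`; Arthur–Clozel 1989,
Ch. 3, proof of Thm. 3.1 and Thm. 4.2 (d): the twists `π ⊗ ηⁱ` are cuspidal with Hecke matrix
`η(ϖ_v)ⁱ t_{π,v}`), granting `artinReciprocity_character`: for a quadratic extension `E/F` and a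
cuspidal `π` on `GL_n(𝔸_F)`, the cuspidal `π' = π ⊗ (ω_{E/F} ∘ det)` (Borel–Jacquet model,
`CuspidalAutomorphicRepData.twist`) has Satake parameter `ε_{E/F}(v) · t_{π,v}` at almost every
`v` (`AutomorphicRepData.eventually_hasSatakeParamAt_twist` and
`exists_heckeCharacter_quadraticSign`).
[cite: ArthurClozelAMS120, Ch. 3, proof of Thm. 3.1 (p. 172) and Thm. 4.2 (d)]
[cite: Tunnell1981, p. 174] -/
theorem exists_twist_quadraticSign_of_reciprocity
    (hR : GaloisRepresentations.artinReciprocity_character) : exists_twist_quadraticSign := by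
  intro n F E _ _ _ _ _ h2 hF π
  obtain ⟨ω, hωfin, hω⟩ := exists_heckeCharacter_quadraticSign hR F E h2
  refine ⟨π.twist ω hωfin, ?_⟩
  filter_upwards [π.1.eventually_hasSatakeParamAt_twist hωfin, hω] with v hv hωv α hα
  rw [← hωv.2]
  exact hv α hα

end Twist

/-! ### Langlands–Tunnell from ten leaves -/

section Leaves

open scoped Classical

/-- **Tunnell's Theorem from ten leaves** (Tunnell 1981, Theorem, p. 175): the strong Artin
conjecture for `σ : Γ_F → GL_2(ℂ)` of octahedral type from Artin reciprocity for characters,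
automorphic induction of characters in prime degree, Langlands' base change for `GL(2)` in three
forms, the Gelbart–Jacquet adjoint lift, Jacquet–Shalika rigidity and the cuspidality of Tunnell's
cubic lifts — `strongArtin_of_isOctahedralType_of_leaves` (`LanglandsTunnellReduction`) with the
quadratic twist discharged by `exists_twist_quadraticSign_of_reciprocity`.
[cite: Tunnell1981, Theorem (p. 175)] [cite: Gelbart1997, §7.2, pp. 257–259] -/
theorem strongArtin_of_isOctahedralType_of_leaves'
    (hR : GaloisRepresentations.artinReciprocity_character) (hAI : automorphicInduction_character)
    (hdesc3 : exists_cuspidal_descent_det_cubic) (hGJ : GelbartJacquet_adjoint_lift)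
    (hJS : JacquetShalika_eq_of_rsData_eq) (hdesc : cuspidal_descent_cyclic)
    (ha : ArthurClozel_fibres_quadratic) (hb : tunnell_cuspidal_cubic_lifts) :
    strongArtin_of_isOctahedralType :=
  strongArtin_of_isOctahedralType_of_leaves hR hAI hdesc3 hGJ hJS hdesc
    (exists_twist_quadraticSign_of_reciprocity hR) ha hb

/-- **The strong Artin conjecture for two-dimensional `σ` with solvable image from ten leaves**
(Tunnell 1981, p. 173; Gelbart 1997, Thm. 2.1 for solvable image): `strongArtin_of_isSolvable`
from the eight named facts of `strongArtin_of_isOctahedralType_of_leaves'`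
(`strongArtin_of_isSolvable_of_leaves` with the quadratic twist discharged).
[cite: Tunnell1981, p. 173 and Theorem] [cite: Gelbart1997, Thm. 2.1] -/
theorem strongArtin_of_isSolvable_of_leaves'
    (hR : GaloisRepresentations.artinReciprocity_character) (hAI : automorphicInduction_character)
    (hdesc3 : exists_cuspidal_descent_det_cubic) (hGJ : GelbartJacquet_adjoint_lift)
    (hJS : JacquetShalika_eq_of_rsData_eq) (hdesc : cuspidal_descent_cyclic)
    (ha : ArthurClozel_fibres_quadratic) (hb : tunnell_cuspidal_cubic_lifts) :
    strongArtin_of_isSolvable :=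
  strongArtin_of_isSolvable_of_leaves hR hAI hdesc3 hGJ hJS hdesc
    (exists_twist_quadraticSign_of_reciprocity hR) ha hb

/-- **lang.S30 (Langlands–Tunnell) from ten leaves**: for every `ρ : Γ_ℚ → GL_2(ℂ)`,
`langlands_tunnell ρ` follows from ten named facts — Artin reciprocity for characters (Tate),
automorphic induction of characters in prime degree (Arthur–Clozel Thm. 6.2), Langlands' base
change for `GL(2)` in three forms (`exists_cuspidal_descent_det_cubic`, `cuspidal_descent_cyclic`,
`ArthurClozel_fibres_quadratic`), the Gelbart–Jacquet adjoint lift, Jacquet–Shalika rigidity, the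
cuspidality of Tunnell's cubic lifts (Jacquet–Piatetski-Shapiro–Shalika 1981), and, over `ℚ`,
Gelbart's Prop. 4.1 (`frobSatakeCompatibleAt_of_isPiOfArtinRep`) and Prop. 4.2
(`exists_isNewform1_of_isPiOfArtinRep`) — `langlands_tunnell_of_leaves`
(`LanglandsTunnellReduction`) with the quadratic twist `exists_twist_quadraticSign` proved from
Artin reciprocity (`exists_twist_quadraticSign_of_reciprocity`).
[cite: Tunnell1981, p. 173, Lemma and Theorem] [cite: Gelbart1997, Thm. 1.3, §2.6, Props. 4.1–4.2,
§7.1–7.2] -/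
theorem langlands_tunnell_of_leaves'
    (hR : GaloisRepresentations.artinReciprocity_character) (hAI : automorphicInduction_character)
    (hdesc3 : exists_cuspidal_descent_det_cubic) (hGJ : GelbartJacquet_adjoint_lift)
    (hJS : JacquetShalika_eq_of_rsData_eq) (hdesc : cuspidal_descent_cyclic)
    (ha : ArthurClozel_fibres_quadratic) (hb : tunnell_cuspidal_cubic_lifts)
    (hAE : frobSatakeCompatibleAt_of_isPiOfArtinRep) (hW1 : exists_isNewform1_of_isPiOfArtinRep)
    (ρ : GaloisRepresentations.FramedArtinRep ℚ 2) : langlands_tunnell ρ :=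
  langlands_tunnell_of_leaves hR hAI hdesc3 hGJ hJS hdesc
    (exists_twist_quadraticSign_of_reciprocity hR) ha hb hAE hW1 ρ

end Leaves

end Literature.NumberTheory.Automorphic

end
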